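import Mathlib
import HarnessLib
import Summits.HubbardSuperconductivity.HubbardSuperconductivity.Theorems.KLProgrammeKLRegimeEngineV8DefsG2

/-!
# Route `KLProgramme` — crux K3, ENGINE child gen 5 (stmt-HubbardSuperconductivity-19918 `KLRegimeEngineV14`), stub `stub_engine_step_values`,
# conjunct (E2-v9) at `1 ≤ n`: the four-term forms of the tower composition on SHAPED majorants — `kltc_fourTerm_shaped_le`

Cell gate-hubbard-kl, seat hubbard-kl-k3c1-p1 (g5), technique «composed-map remainder propagation».  Companion of
`…EnginePairLadderTowerCompose` (`kltc_tower_compose` / `pairLadderStepAtV9_of_wickTower`): there the plain (E2-v9) error is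
`E″ + FT_{|μ|}(E₁)`, `E₁ ≥ E_a + FT_{|w₁+μ′|}(E′)`, with the weighted four-term form
`FT_ρ(E)(x,y) = E(x,y) + p·Σ_b E(x,b)ρ_b + q·Σ_a ρ_a E(a,y) + r·Σ_aΣ_b ρ_a E(a,b)ρ_b`.
The tower's error majorants have the SHAPE of the (E2-v9) budget line — a uniform part, per-index leg allowances, and a particle–hole source
part `c·(φ(x − y) + φ(x + y − Q))` (E2-DRIVE, `φ = phGain n ∘ |·|_𝕋`, even) — and against that shape the four-term form closes in scalars once
the weight profile has an ANGULAR MASS `Σ_b ρ_b·φ(b − c₀) ≤ ε` uniform in the centre (thin forward sectors carry little weight; k3c2-p2's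
coarea lane) and a leg-weighted mass; the output has the same shape, so the bound iterates through both forms (§1, generic over any finite
additive group of momenta).  §2: the package profile one scale down, `klEngGeo3.phGain (n−1) ρ ≤ 4·klEngGeo3.phGain n ρ` — the straddle
relation of scale `n−1` is read at step `n`.  Composability remark (for the private tower's typist): the source coefficients ADD through the
composition (`4c′ + c_a + c″` at the external entry against the slot's `(P.Klam·U)²`) and the leg allowances inflate by `(1 + pZ)`-type factors,
so the private relations (W-a)/(W-c) want fractional coefficients, not three copies of the slot line.  Arithmetic only; 0 kit.
-/

noncomputable section

namespace Summit.HubbardSuperconductivity.HubbardSuperconductivity.Theorems.KLRegimeSplit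

set_option linter.dupNamespace false -- summit = problem name (single-conjunct summit), D-0017

open Finset

/-! ## §1 The four-term form of a shaped majorant

The error majorants of the tower have the shape of the (E2-v9) budget line: a uniform part, per-index leg allowances, and a particle–hole
SOURCE part `c·(φ(x − y) + φ(x + y − Q))` (E2-DRIVE: `φ = phGain n ∘ |·|_𝕋`, even).  Against such a shape the weighted sums of
`kltc_tower_compose` close in scalars once the weight profile has an ANGULAR MASS `Σ_b ρ_b·φ(b − c₀) ≤ ε` uniformly in the centre `c₀`
(thin forward sectors carry little weight) and a leg-weighted mass; and the output is again of the same shape — so the bound iterates through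
both four-term forms.  Generic over any finite additive group of momenta. -/

section Shaped

variable {S : Type*} [Fintype S] [AddCommGroup S]

/-- **Four-term form of a shaped majorant.**  If `E(x,y) ≤ u + λ_R(x) + λ_C(y) + c·(φ(x−y) + φ(x+y−Q))` with `u, c ≥ 0`, `λ_R, λ_C, φ ≥ 0`,
`φ` even, and the weight profile `ρ ≥ 0` has mass `Σρ ≤ Z`, leg-weighted masses `Σρλ_R ≤ Λ_R`, `Σρλ_C ≤ Λ_C` and angular mass
`Σ_b ρ_b φ(b − c₀) ≤ ε` for every centre `c₀`, then for `p, q, r ≥ 0`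
`E(x,y) + p·Σ_b E(x,b)ρ_b + q·Σ_a ρ_a E(a,y) + r·Σ_aΣ_b ρ_a E(a,b)ρ_b ≤
 [u(1 + pZ + qZ + rZ²) + pΛ_C + qΛ_R + rZ(Λ_R + Λ_C) + 2cε(p + q + rZ)] + (1 + pZ)λ_R(x) + (1 + qZ)λ_C(y) + c·(φ(x−y) + φ(x+y−Q))`
— the same shape again (the source part is NOT inflated: its dressings are angular-small). -/
theorem kltc_fourTerm_shaped_le (E : S → S → ℝ) (ρ lamR lamC φ : S → ℝ) (Q : S) {u c p q r Z Λr Λc ε : ℝ}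
    (hu : 0 ≤ u) (hc : 0 ≤ c) (hp : 0 ≤ p) (hq : 0 ≤ q) (hr : 0 ≤ r)
    (hρ : ∀ a, 0 ≤ ρ a) (hlamR : ∀ a, 0 ≤ lamR a) (hlamC : ∀ a, 0 ≤ lamC a) (hφ0 : ∀ v, 0 ≤ φ v) (hφ : ∀ v, φ (-v) = φ v)
    (hE : ∀ x y, E x y ≤ u + lamR x + lamC y + c * (φ (x - y) + φ (x + y - Q)))
    (hZ : ∑ a, ρ a ≤ Z) (hΛr : ∑ a, ρ a * lamR a ≤ Λr) (hΛc : ∑ a, ρ a * lamC a ≤ Λc)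
    (hang : ∀ c₀ : S, ∑ b, ρ b * φ (b - c₀) ≤ ε) (x y : S) :
    E x y + p * ∑ b, E x b * ρ b + q * ∑ a, ρ a * E a y + r * ∑ a, ∑ b, ρ a * E a b * ρ b ≤
      (u * (1 + p * Z + q * Z + r * Z * Z) + p * Λc + q * Λr + r * Z * (Λr + Λc) + 2 * c * ε * (p + q + r * Z)) +
        (1 + p * Z) * lamR x + (1 + q * Z) * lamC y + c * (φ (x - y) + φ (x + y - Q)) := by
  have hZ0 : 0 ≤ Z := (sum_nonneg fun a _ => hρ a).trans hZ
  have hε0 : 0 ≤ ε := (sum_nonneg fun b _ => mul_nonneg (hρ b) (hφ0 _)).trans (hang x)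
  have hΛc0 : 0 ≤ Λc := (sum_nonneg fun a _ => mul_nonneg (hρ a) (hlamC a)).trans hΛc
  -- angular sums at the four centres
  have hang_row1 : ∀ x : S, ∑ b, ρ b * φ (x - b) ≤ ε := by
    intro x
    have h := hang x
    calc ∑ b, ρ b * φ (x - b) = ∑ b, ρ b * φ (b - x) := sum_congr rfl fun b _ => by rw [← neg_sub, hφ]
      _ ≤ ε := h
  have hang_row2 : ∀ x : S, ∑ b, ρ b * φ (x + b - Q) ≤ ε := by
    intro x
    have h := hang (Q - x)
    calc ∑ b, ρ b * φ (x + b - Q) = ∑ b, ρ b * φ (b - (Q - x)) := sum_congr rfl fun b _ => by congr 2; abel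
      _ ≤ ε := h
  have hang_col2 : ∀ y : S, ∑ a, ρ a * φ (a + y - Q) ≤ ε := by
    intro y
    have h := hang (Q - y)
    calc ∑ a, ρ a * φ (a + y - Q) = ∑ a, ρ a * φ (a - (Q - y)) := sum_congr rfl fun a _ => by congr 2; abel
      _ ≤ ε := h
  -- row sums
  have hrow : ∀ x : S, ∑ b, E x b * ρ b ≤ (u + lamR x) * Z + Λc + 2 * c * ε := by
    intro x
    have hsplit : ∀ b, (u + lamR x + lamC b + c * (φ (x - b) + φ (x + b - Q))) * ρ b =
        (u + lamR x) * ρ b + ρ b * lamC b + c * (ρ b * φ (x - b)) + c * (ρ b * φ (x + b - Q)) := fun b => by ring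
    calc ∑ b, E x b * ρ b ≤ ∑ b, (u + lamR x + lamC b + c * (φ (x - b) + φ (x + b - Q))) * ρ b :=
          sum_le_sum fun b _ => mul_le_mul_of_nonneg_right (hE x b) (hρ b)
      _ = (u + lamR x) * ∑ b, ρ b + ∑ b, ρ b * lamC b + c * ∑ b, ρ b * φ (x - b) + c * ∑ b, ρ b * φ (x + b - Q) := by
          rw [sum_congr rfl fun b _ => hsplit b, sum_add_distrib, sum_add_distrib, sum_add_distrib, ← mul_sum, ← mul_sum,
            ← mul_sum]
      _ ≤ (u + lamR x) * Z + Λc + c * ε + c * ε :=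
          add_le_add (add_le_add (add_le_add (mul_le_mul_of_nonneg_left hZ (add_nonneg hu (hlamR x))) hΛc)
            (mul_le_mul_of_nonneg_left (hang_row1 x) hc)) (mul_le_mul_of_nonneg_left (hang_row2 x) hc)
      _ = (u + lamR x) * Z + Λc + 2 * c * ε := by ring
  -- column sums
  have hcol : ∑ a, ρ a * E a y ≤ (u + lamC y) * Z + Λr + 2 * c * ε := by
    have hsplit : ∀ a, ρ a * (u + lamR a + lamC y + c * (φ (a - y) + φ (a + y - Q))) =
        (u + lamC y) * ρ a + ρ a * lamR a + c * (ρ a * φ (a - y)) + c * (ρ a * φ (a + y - Q)) := fun a => by ring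
    calc ∑ a, ρ a * E a y ≤ ∑ a, ρ a * (u + lamR a + lamC y + c * (φ (a - y) + φ (a + y - Q))) :=
          sum_le_sum fun a _ => mul_le_mul_of_nonneg_left (hE a y) (hρ a)
      _ = (u + lamC y) * ∑ a, ρ a + ∑ a, ρ a * lamR a + c * ∑ a, ρ a * φ (a - y) + c * ∑ a, ρ a * φ (a + y - Q) := by
          rw [sum_congr rfl fun a _ => hsplit a, sum_add_distrib, sum_add_distrib, sum_add_distrib, ← mul_sum, ← mul_sum,
            ← mul_sum]
      _ ≤ (u + lamC y) * Z + Λr + c * ε + c * ε :=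
          add_le_add (add_le_add (add_le_add (mul_le_mul_of_nonneg_left hZ (add_nonneg hu (hlamC y))) hΛr)
            (mul_le_mul_of_nonneg_left (hang y) hc)) (mul_le_mul_of_nonneg_left (hang_col2 y) hc)
      _ = (u + lamC y) * Z + Λr + 2 * c * ε := by ring
  -- double sum
  have hdbl : ∑ a, ∑ b, ρ a * E a b * ρ b ≤ u * Z * Z + Z * Λr + Z * (Λc + 2 * c * ε) := by
    calc ∑ a, ∑ b, ρ a * E a b * ρ b = ∑ a, ρ a * ∑ b, E a b * ρ b := by
          refine sum_congr rfl fun a _ => ?_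
          rw [Finset.mul_sum]
          exact sum_congr rfl fun b _ => by ring
      _ ≤ ∑ a, ρ a * ((u + lamR a) * Z + Λc + 2 * c * ε) :=
          sum_le_sum fun a _ => mul_le_mul_of_nonneg_left (hrow a) (hρ a)
      _ = u * Z * ∑ a, ρ a + Z * ∑ a, ρ a * lamR a + (Λc + 2 * c * ε) * ∑ a, ρ a := by
          have hsplit : ∀ a, ρ a * ((u + lamR a) * Z + Λc + 2 * c * ε) =
              u * Z * ρ a + Z * (ρ a * lamR a) + (Λc + 2 * c * ε) * ρ a := fun a => by ring
          rw [sum_congr rfl fun a _ => hsplit a, sum_add_distrib, sum_add_distrib, ← mul_sum, ← mul_sum, ← mul_sum]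
      _ ≤ u * Z * Z + Z * Λr + (Λc + 2 * c * ε) * Z :=
          add_le_add (add_le_add (mul_le_mul_of_nonneg_left hZ (mul_nonneg hu hZ0)) (mul_le_mul_of_nonneg_left hΛr hZ0))
            (mul_le_mul_of_nonneg_left hZ (by positivity))
      _ = u * Z * Z + Z * Λr + Z * (Λc + 2 * c * ε) := by ring
  -- assemble
  have e1 := hE x y
  have e2 : p * ∑ b, E x b * ρ b ≤ p * ((u + lamR x) * Z + Λc + 2 * c * ε) := mul_le_mul_of_nonneg_left (hrow x) hp
  have e3 : q * ∑ a, ρ a * E a y ≤ q * ((u + lamC y) * Z + Λr + 2 * c * ε) := mul_le_mul_of_nonneg_left hcol hq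
  have e4 : r * ∑ a, ∑ b, ρ a * E a b * ρ b ≤ r * (u * Z * Z + Z * Λr + Z * (Λc + 2 * c * ε)) :=
    mul_le_mul_of_nonneg_left hdbl hr
  nlinarith [e1, e2, e3, e4]


/-- **The composed tower budget on shaped majorants (both four-term forms discharged).**  With the three error majorants of
`kltc_tower_compose` shaped over ONE leg function `λ ≥ 0` and ONE even source profile `φ ≥ 0`,
`E′ ≤ u′ + l′(λx + λy) + c′Φ`, `E_a ≤ u_a + l_a(λx + λy) + c_aΦ`, `E″ ≤ u″ + l″(λx + λy) + c″Φ` (`Φ = φ(x−y) + φ(x+y−Q)`), the first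
profile `ρ` (`≥ |w₁ + μ′|`: mass `Z₁`, leg mass `Λ₁`, angular mass `ε₁`) and the second `σ` (`≥ |μ|`: `Z₂, Λ₂, ε₂`), and `E₁ ≤ E_a + FT_ρ(E′)`
(coefficients `p₁, q₁, r₁`), the final line `E″ + FT_σ(E₁)` (coefficients `p₂, q₂, r₂`) is bounded by an explicit uniform constant plus
inflated leg allowances plus `(c′ + c_a + c″)·Φ` — the source coefficients ADD, undressed. -/
theorem kltc_tower_budget_shaped (E' Ea E'' E₁ : S → S → ℝ) (ρ σ lam φ : S → ℝ) (Q : S)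
    {u' ua u'' l' la l'' c' ca c'' p₁ q₁ r₁ p₂ q₂ r₂ Z₁ Z₂ Λ₁ Λ₂ ε₁ ε₂ : ℝ}
    (hu' : 0 ≤ u') (hua : 0 ≤ ua) (hl' : 0 ≤ l') (hla : 0 ≤ la) (hc' : 0 ≤ c') (hca : 0 ≤ ca)
    (hp₁ : 0 ≤ p₁) (hq₁ : 0 ≤ q₁) (hr₁ : 0 ≤ r₁) (hp₂ : 0 ≤ p₂) (hq₂ : 0 ≤ q₂) (hr₂ : 0 ≤ r₂)
    (hρ : ∀ a, 0 ≤ ρ a) (hσ : ∀ a, 0 ≤ σ a) (hlam : ∀ a, 0 ≤ lam a) (hφ0 : ∀ v, 0 ≤ φ v) (hφ : ∀ v, φ (-v) = φ v)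
    (hE' : ∀ x y, E' x y ≤ u' + l' * lam x + l' * lam y + c' * (φ (x - y) + φ (x + y - Q)))
    (hEa : ∀ x y, Ea x y ≤ ua + la * lam x + la * lam y + ca * (φ (x - y) + φ (x + y - Q)))
    (hE'' : ∀ x y, E'' x y ≤ u'' + l'' * lam x + l'' * lam y + c'' * (φ (x - y) + φ (x + y - Q)))
    (hZ₁ : ∑ a, ρ a ≤ Z₁) (hΛ₁ : ∑ a, ρ a * lam a ≤ Λ₁) (hang₁ : ∀ c₀ : S, ∑ b, ρ b * φ (b - c₀) ≤ ε₁)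
    (hZ₂ : ∑ a, σ a ≤ Z₂) (hΛ₂ : ∑ a, σ a * lam a ≤ Λ₂) (hang₂ : ∀ c₀ : S, ∑ b, σ b * φ (b - c₀) ≤ ε₂)
    (hE₁ : ∀ x y, E₁ x y ≤ Ea x y + (E' x y + p₁ * ∑ b, E' x b * ρ b + q₁ * ∑ a, ρ a * E' a y + r₁ * ∑ a, ∑ b, ρ a * E' a b * ρ b))
    (x y : S) :
    E'' x y + (E₁ x y + p₂ * ∑ b, E₁ x b * σ b + q₂ * ∑ a, σ a * E₁ a y + r₂ * ∑ a, ∑ b, σ a * E₁ a b * σ b) ≤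
      (u'' + ((ua + (u' * (1 + p₁ * Z₁ + q₁ * Z₁ + r₁ * Z₁ * Z₁) + p₁ * (l' * Λ₁) + q₁ * (l' * Λ₁) + r₁ * Z₁ * (l' * Λ₁ + l' * Λ₁) +
          2 * c' * ε₁ * (p₁ + q₁ + r₁ * Z₁))) * (1 + p₂ * Z₂ + q₂ * Z₂ + r₂ * Z₂ * Z₂) +
          p₂ * ((la + (1 + q₁ * Z₁) * l') * Λ₂) + q₂ * ((la + (1 + p₁ * Z₁) * l') * Λ₂) +
          r₂ * Z₂ * ((la + (1 + p₁ * Z₁) * l') * Λ₂ + (la + (1 + q₁ * Z₁) * l') * Λ₂) + 2 * (ca + c') * ε₂ * (p₂ + q₂ + r₂ * Z₂))) +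
        (l'' + (1 + p₂ * Z₂) * (la + (1 + p₁ * Z₁) * l')) * lam x + (l'' + (1 + q₂ * Z₂) * (la + (1 + q₁ * Z₁) * l')) * lam y +
        (c' + ca + c'') * (φ (x - y) + φ (x + y - Q)) := by
  have hZ₁0 : 0 ≤ Z₁ := (sum_nonneg fun a _ => hρ a).trans hZ₁
  have hΛ₁0 : 0 ≤ Λ₁ := (sum_nonneg fun a _ => mul_nonneg (hρ a) (hlam a)).trans hΛ₁
  have hε₁0 : 0 ≤ ε₁ := (sum_nonneg fun b _ => mul_nonneg (hρ b) (hφ0 _)).trans (hang₁ x)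
  -- level 1: the shape of `FT_ρ(E′)`, hence of `E₁`
  have hΛ₁' : ∑ a, ρ a * (l' * lam a) ≤ l' * Λ₁ := by
    calc ∑ a, ρ a * (l' * lam a) = l' * ∑ a, ρ a * lam a := by rw [mul_sum]; exact sum_congr rfl fun a _ => by ring
      _ ≤ l' * Λ₁ := mul_le_mul_of_nonneg_left hΛ₁ hl'
  have h1 : ∀ a b, E' a b + p₁ * ∑ t, E' a t * ρ t + q₁ * ∑ s, ρ s * E' s b + r₁ * ∑ s, ∑ t, ρ s * E' s t * ρ t ≤
      (u' * (1 + p₁ * Z₁ + q₁ * Z₁ + r₁ * Z₁ * Z₁) + p₁ * (l' * Λ₁) + q₁ * (l' * Λ₁) + r₁ * Z₁ * (l' * Λ₁ + l' * Λ₁) +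
          2 * c' * ε₁ * (p₁ + q₁ + r₁ * Z₁)) +
        (1 + p₁ * Z₁) * (l' * lam a) + (1 + q₁ * Z₁) * (l' * lam b) + c' * (φ (a - b) + φ (a + b - Q)) := fun a b =>
    kltc_fourTerm_shaped_le E' ρ (fun s => l' * lam s) (fun s => l' * lam s) φ Q hu' hc' hp₁ hq₁ hr₁ hρ
      (fun s => mul_nonneg hl' (hlam s)) (fun s => mul_nonneg hl' (hlam s)) hφ0 hφ hE' hZ₁ hΛ₁' hΛ₁' hang₁ a b
  have hU₁0 : 0 ≤ (u' * (1 + p₁ * Z₁ + q₁ * Z₁ + r₁ * Z₁ * Z₁) + p₁ * (l' * Λ₁) + q₁ * (l' * Λ₁) + r₁ * Z₁ * (l' * Λ₁ + l' * Λ₁) +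
          2 * c' * ε₁ * (p₁ + q₁ + r₁ * Z₁)) := by positivity
  have hE₁shape : ∀ a b, E₁ a b ≤ (ua + (u' * (1 + p₁ * Z₁ + q₁ * Z₁ + r₁ * Z₁ * Z₁) + p₁ * (l' * Λ₁) + q₁ * (l' * Λ₁) + r₁ * Z₁ * (l' * Λ₁ + l' * Λ₁) +
          2 * c' * ε₁ * (p₁ + q₁ + r₁ * Z₁))) +
      (la + (1 + p₁ * Z₁) * l') * lam a + (la + (1 + q₁ * Z₁) * l') * lam b + (ca + c') * (φ (a - b) + φ (a + b - Q)) := by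
    intro a b
    linarith [hE₁ a b, hEa a b, h1 a b]
  -- level 2: `FT_σ(E₁)`
  have hlR0 : 0 ≤ la + (1 + p₁ * Z₁) * l' := by positivity
  have hlC0 : 0 ≤ la + (1 + q₁ * Z₁) * l' := by positivity
  have hΛR : ∑ a, σ a * ((la + (1 + p₁ * Z₁) * l') * lam a) ≤ (la + (1 + p₁ * Z₁) * l') * Λ₂ := by
    calc ∑ a, σ a * ((la + (1 + p₁ * Z₁) * l') * lam a) = (la + (1 + p₁ * Z₁) * l') * ∑ a, σ a * lam a := by
          rw [mul_sum]; exact sum_congr rfl fun a _ => by ring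
      _ ≤ (la + (1 + p₁ * Z₁) * l') * Λ₂ := mul_le_mul_of_nonneg_left hΛ₂ hlR0
  have hΛC : ∑ a, σ a * ((la + (1 + q₁ * Z₁) * l') * lam a) ≤ (la + (1 + q₁ * Z₁) * l') * Λ₂ := by
    calc ∑ a, σ a * ((la + (1 + q₁ * Z₁) * l') * lam a) = (la + (1 + q₁ * Z₁) * l') * ∑ a, σ a * lam a := by
          rw [mul_sum]; exact sum_congr rfl fun a _ => by ring
      _ ≤ (la + (1 + q₁ * Z₁) * l') * Λ₂ := mul_le_mul_of_nonneg_left hΛ₂ hlC0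
  have h2 := kltc_fourTerm_shaped_le E₁ σ (fun s => (la + (1 + p₁ * Z₁) * l') * lam s) (fun s => (la + (1 + q₁ * Z₁) * l') * lam s)
    φ Q (add_nonneg hua hU₁0) (add_nonneg hca hc') hp₂ hq₂ hr₂ hσ (fun s => mul_nonneg hlR0 (hlam s))
    (fun s => mul_nonneg hlC0 (hlam s)) hφ0 hφ hE₁shape hZ₂ hΛR hΛC hang₂ x y
  beta_reduce at h2
  linarith [h2, hE'' x y]

end Shaped

/-! ## §2 The crossed-channel gain profile of `klEngGeo3` one scale down

The straddle relation (W-c)_{n−1} is read at step `n` with its scale-`(n−1)` source part; for the package profile the comparison is a factor `4`. -/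

/-- `klEngGeo3.phGain (n − 1) ρ ≤ 4·klEngGeo3.phGain n ρ`: every branch of `phGainOf 2^24 2^24 2^24 2^24 0 klE0 · · (max ρ 0)` grows by at most
`4` from `n` to `n − 1` (`4^{−(n−1)} = 4·4^{−n}`, `4^{n−1} ≤ 4^n`, `2^{−(n−1)} = 2·2^{−n}`). -/
theorem klEngGeo3_phGain_pred_le (n : ℕ) (ρ : ℝ) : EngineV8.klEngGeo3.phGain (n - 1) ρ ≤ 4 * EngineV8.klEngGeo3.phGain n ρ := by
  rcases Nat.eq_zero_or_pos n with hn | hn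
  · subst hn
    have h0 : 0 ≤ EngineV8.klEngGeo3.phGain 0 ρ := (EngineV8.klEngGeo3_wf).2.2.2.2.2.2.2.2.2.2.2.2.1 0 ρ
    rw [Nat.zero_sub]; linarith
  · obtain ⟨k, rfl⟩ : ∃ k, n = k + 1 := ⟨n - 1, by omega⟩
    simp only [Nat.add_sub_cancel, EngineV8.klEngGeo3, phGainOf, zero_mul, add_zero, sub_zero]
    set t : ℝ := max ρ 0 with ht_def
    have ht0 : 0 ≤ t := le_max_right _ _
    have he : 0 < klE0 := by norm_num [klE0]
    have h4k : (0 : ℝ) < (4 : ℝ) ^ k := by positivity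
    have h2k : (0 : ℝ) < (2 : ℝ) ^ k := by positivity
    have h4 : (4 : ℝ) ^ (k + 1) = 4 ^ k * 4 := pow_succ _ _
    have h2 : (2 : ℝ) ^ (k + 1) = 2 ^ k * 2 := pow_succ _ _
    -- the two inner bounds at `k` vs `k + 1`
    have hA : (2 : ℝ) ^ 24 * ((4 : ℝ) ^ k)⁻¹ + 2 ^ 24 * t / klE0 * (4 : ℝ) ^ k ≤
        4 * ((2 : ℝ) ^ 24 * ((4 : ℝ) ^ (k + 1))⁻¹ + 2 ^ 24 * t / klE0 * (4 : ℝ) ^ (k + 1)) := by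
      rw [h4]
      have hB : 0 ≤ (2 : ℝ) ^ 24 * t / klE0 * 4 ^ k := by positivity
      have key : 4 * ((2 : ℝ) ^ 24 * ((4 : ℝ) ^ k * 4)⁻¹ + 2 ^ 24 * t / klE0 * ((4 : ℝ) ^ k * 4)) =
          2 ^ 24 * ((4 : ℝ) ^ k)⁻¹ + 16 * (2 ^ 24 * t / klE0 * 4 ^ k) := by
        field_simp; ring
      rw [key]; linarith
    have hmin : ∀ a a' b b' : ℝ, a' ≤ 4 * a → b' ≤ 4 * b → min 1 (min a' b') ≤ 4 * min 1 (min a b) := by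
      intro a a' b b' ha hb
      rcases le_total 1 (min a b) with h | h
      · rw [min_eq_left h]; linarith [min_le_left (1 : ℝ) (min a' b')]
      · rw [min_eq_right h]
        calc min 1 (min a' b') ≤ min a' b' := min_le_right _ _
          _ ≤ min (4 * a) (4 * b) := min_le_min ha hb
          _ = 4 * min a b := (mul_min_of_nonneg a b (by norm_num : (0 : ℝ) ≤ 4)).symm
    refine hmin _ _ _ _ hA ?_
    by_cases hcond : 0 < t
    · rw [if_pos hcond, if_pos hcond, h4, h2]
      have h1 : 0 ≤ (2 : ℝ) ^ 24 * Real.sqrt klE0 * ((2 : ℝ) ^ k)⁻¹ := by positivity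
      have key : 4 * ((2 : ℝ) ^ 24 * (klE0 * ((4 : ℝ) ^ k * 4)⁻¹) / t + 2 ^ 24 * Real.sqrt klE0 * ((2 : ℝ) ^ k * 2)⁻¹) =
          2 ^ 24 * (klE0 * ((4 : ℝ) ^ k)⁻¹) / t + 2 * (2 ^ 24 * Real.sqrt klE0 * ((2 : ℝ) ^ k)⁻¹) := by
        field_simp; ring
      rw [key]; linarith
    · rw [if_neg hcond, if_neg hcond]; norm_num

end Summit.HubbardSuperconductivity.HubbardSuperconductivity.Theorems.KLRegimeSplit

end
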